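import Summits.CriticalPhenomena.Ising3D.Control2DOpeTail
import Mathlib.Tactic.Linarith
import Mathlib.Tactic.Positivity
import Mathlib.Tactic.FieldSimp
import Mathlib.Tactic.Ring
import Mathlib.Tactic.LinearCombination
import HarnessLib

/-!
# Kind `ope2`, sense LOWER, from KERNEL data: the scalar `T` head and the integer sign check
(cell `pub-ising3x`, seat controls-1 gen 21; KERNEL PATH for the 2D γ-certificates, kind `ope2`, sense lower — CONTROL-ONLY)

HONEST FRAMING: lottery ticket; floor = tightest certified 3D Ising CFT bounds; no exact-solution
claim without a proof. CONTROL-ONLY (`d = 2`, `Δ_σ = 1/8`, axiom set `A2D′`); nothing numerical is asserted here.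

`Control2DOpeTail.opeLower_half_of_cellsN` reduces `OpeLowerA2D` (`P < p_T`, the `c` UPPER edge) to the box-kind cells record,
(R), (I′) on the truncated `(2,2)` block and ONE sign check `φ[F_-[Q_{N_T}(2,2)]] + (explicit tail majorant) < 0`. The majorant is
coarse, so `N_T` must exceed the cells' truncation orders (Λ = 19: `N_T ≥ 96` vs `Nd + 1 = 72` for the spin-2 cells); taking the
`T` value from the head of the spin-2 cell POLYNOMIAL (as the upper-sense replays do, `Control2DOpeCells`) would make that
polynomial far too expensive. But the `T` point is ONE point (`h = 2`, `h̄ = 0`): this file evaluates the kernel's coefficient lists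
there as SCALAR integers, by structural recursion only (no `Finset` folds — measured: the `Finset` form of the same objects trips
the kernel's memory guard at `Nd = 127`, the structural form decides in seconds): `zevalZ` (Horner at an integer point), `ahat0`
(`Â_m(0)`), `u0Z` (`U_k(0)`), **`tHeadZ wt Sl Λ Nd`** with `evalR_cellPolyZ_two_zero : P̂₂(0) = tHeadZ` and hence
**`tHeadZ_eq : tHeadZ = cellConst Λ 2 Nd 2 · φ[F^{1/8}_-[Q_{Nd+1}(2,2)]]`** (through the landed `evalR_cellPolyZ`; no new analysis),
and the form the kernel actually evaluates, **`tHeadOf (uvec Nd 2 Λ) (uvec Nd 0 Λ) wt Sl Λ`** (all `U_k(0)`, `k ≤ Λ`, in ONE pass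
over the levels, `tHeadOf_uvec_eq`). **`opeLower_half_of_cellsZ`** is the shape a replay instantiates at `Δ_σ = 1/8`, bound
`P = Pn/Pd`: (I′) as `0 < Pd·identZ·4^{Nd+1}·D₂D₀ + Pn·T̂` (as in `opeUpper_half_of_cellsZ`, with the scalar head and
`D_c = denProd0 Nd c`) and the sign check as `T̂·(Nd+4-Λ) + tailZ < 0`, `tailZ = 8^Λ Λ!² D₂ D₀ · 2^{Nd+1} C(Nd+3+Λ, Λ) (Nd+4) · W`
(`W = Σ |wt_p| c_p`; `cast_tailZ`: `tailZ = cellConst · (1/2)^{1/4}·2W·tailMajor Λ (Nd+3) · (Nd+4-Λ)`), both decidable by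
`decide +kernel` (measured on the Λ = 19 table of record at `Nd = 127`: 15 s for both, farm). PROVED; no facts, standard axioms only.
[cite: RattazziEtAl2008, §5]
-/

namespace Summit.CriticalPhenomena.Ising3D.Control2D

open Finset Set
open Literature.Analysis.ValidatedNumerics.PolyMP
open Literature.MathematicalPhysics.QuantumFieldTheory.ConformalBootstrap3D

/-! ### Structural integer evaluators (kernel-friendly) -/

/-- Horner evaluation of an integer coefficient list at an integer point. [folklore] -/
def zevalZ : List ℤ → ℤ → ℤ
  | [], _ => 0
  | a :: as, x => a + x * zevalZ as x

/-- [folklore] -/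
theorem evalR_castZ_intCast : ∀ (l : List ℤ) (x : ℤ), evalR (castZ l) (x : ℝ) = ((zevalZ l x : ℤ) : ℝ)
  | [], x => by simp [zevalZ]
  | a :: as, x => by
      rw [castZ_cons, evalR_cons, zevalZ, evalR_castZ_intCast as x]
      push_cast
      ring

/-- `Σ_{i<n} f i` by structural recursion. [folklore] -/
def zsumNat (f : ℕ → ℤ) : ℕ → ℤ
  | 0 => 0
  | n + 1 => zsumNat f n + f n

/-- [folklore] -/
theorem zsumNat_eq (f : ℕ → ℤ) : ∀ n : ℕ, zsumNat f n = ∑ i ∈ range n, f i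
  | 0 => by simp [zsumNat]
  | n + 1 => by rw [zsumNat, zsumNat_eq f n, sum_range_succ]

/-- `∏_{i<n} f i` by structural recursion. [folklore] -/
def zprodNat (f : ℕ → ℤ) : ℕ → ℤ
  | 0 => 1
  | n + 1 => zprodNat f n * f n

/-- [folklore] -/
theorem zprodNat_eq (f : ℕ → ℤ) : ∀ n : ℕ, zprodNat f n = ∏ i ∈ range n, f i
  | 0 => by simp [zprodNat]
  | n + 1 => by rw [zprodNat, zprodNat_eq f n, prod_range_succ]

/-- The chiral-factor numerator at `y = 0` (`h = c`): `c` (`i = 0`), `(c+i)²` (`i ≥ 1`). [folklore] -/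
def num0 (c i : ℕ) : ℤ := if i = 0 then (c : ℤ) else (((c + i) ^ 2 : ℕ) : ℤ)

/-- The chiral-factor denominator at `y = 0`: `2` (`i = 0`), `(i+1)(2c+i)` (`i ≥ 1`). [folklore] -/
def den0 (c i : ℕ) : ℤ := if i = 0 then 2 else (((i + 1) * (2 * c + i) : ℕ) : ℤ)

/-- [folklore] -/
theorem evalR_numZ_zero (c i : ℕ) : evalR (castZ (numZ c i)) 0 = ((num0 c i : ℤ) : ℝ) := by
  rw [evalR_numZ]
  unfold num0
  split_ifs <;> push_cast <;> ring

/-- [folklore] -/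
theorem evalR_denZ_zero (c i : ℕ) : evalR (castZ (denZ c i)) 0 = ((den0 c i : ℤ) : ℝ) := by
  rw [evalR_denZ]
  unfold den0
  split_ifs <;> push_cast <;> ring

/-- The common denominator at `y = 0`: `D_c = ∏_{i<Nd} den0 c i` (`= denProd Nd c 0`). [folklore] -/
def denProd0 (Nd c : ℕ) : ℤ := zprodNat (den0 c) Nd

/-- [folklore] -/
theorem denProd_zero_eq (Nd c : ℕ) : denProd Nd c 0 = ((denProd0 Nd c : ℤ) : ℝ) := by
  rw [denProd, denProd0, zprodNat_eq, Int.cast_prod]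
  exact Finset.prod_congr rfl fun i _ => evalR_denZ_zero c i

/-- `Â_m(0) = ∏_{i<m} num0_i · ∏_{j<Nd-m} den0_{m+j}` as an integer. [folklore] -/
def ahat0 (Nd c m : ℕ) : ℤ := zprodNat (num0 c) m * zprodNat (fun j => den0 c (m + j)) (Nd - m)

/-- [folklore] -/
theorem evalR_ahatZ_zero (Nd c m : ℕ) : evalR (castZ (ahatZ Nd c m)) 0 = ((ahat0 Nd c m : ℤ) : ℝ) := by
  rw [ahatZ, evalR_zmul, evalR_zprodRange, evalR_zprodRange, ahat0, zprodNat_eq, zprodNat_eq]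
  simp only [evalR_numZ_zero, evalR_denZ_zero]
  push_cast
  rfl

/-- `U_k(0) = Σ_{m ≤ Nd} 2^{Nd-m} Â_m(0) Q̃_k(c + m)` as an integer. [folklore] -/
def u0Z (Nd c k : ℕ) : ℤ :=
  zsumNat (fun m => 2 ^ (Nd - m) * ahat0 Nd c m * zevalZ (qtZ k) ((c + m : ℕ) : ℤ)) (Nd + 1)

/-- [folklore] -/
theorem evalR_uZ_zero (Nd c k : ℕ) : evalR (castZ (uZ Nd c k)) 0 = ((u0Z Nd c k : ℤ) : ℝ) := by
  rw [uZ, evalR_zsumRange, u0Z, zsumNat_eq]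
  push_cast
  refine Finset.sum_congr rfl fun m _ => ?_
  rw [evalR_zsmul, evalR_zmul, evalR_ahatZ_zero, evalR_zshift, add_zero, evalR_castZ_intCast]
  push_cast
  ring

/-- **The integer `T` head** `T̂(Nd) = Σ_{p∈Sl} ω_p (U⁽²⁾_{p₁}(0) U⁽⁰⁾_{p₂}(0) + U⁽⁰⁾_{p₁}(0) U⁽²⁾_{p₂}(0))` — the constant
coefficient of the spin-2 cell polynomial, defined WITHOUT the polynomial. [folklore] -/
def tHeadZ (wt : ℕ × ℕ → ℤ) (Sl : List (ℕ × ℕ)) (Λ Nd : ℕ) : ℤ :=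
  (Sl.map fun p => omegaZ Λ wt p * (u0Z Nd 2 p.1 * u0Z Nd 0 p.2 + u0Z Nd 0 p.1 * u0Z Nd 2 p.2)).sum

/-- `P̂₂(0) = T̂`. [folklore] -/
theorem evalR_cellPolyZ_two_zero (wt : ℕ × ℕ → ℤ) (Sl : List (ℕ × ℕ)) (Λ Nd : ℕ) :
    evalR (castZ (cellPolyZ wt Sl Λ 2 Nd)) 0 = ((tHeadZ wt Sl Λ Nd : ℤ) : ℝ) := by
  rw [cellPolyZ, evalR_zsumList, tHeadZ, Int.cast_list_sum, List.map_map]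
  congr 1
  refine List.map_congr_left fun p _ => ?_
  simp only [Function.comp, evalR_zsmul, evalR_zadd, evalR_zmul, evalR_uZ_zero]
  push_cast
  ring

/-- **Meaning of the integer `T` head**: `T̂(Nd) = cellConst Λ 2 Nd 2 · φ[F^{1/8}_-[Q_{Nd+1}(2,2)]]`,
`φ = taylorFunctional2D (1/2) Sl.toFinset wt` (from `evalR_cellPolyZ` at `Δ = ℓ = 2`). [folklore] -/
theorem tHeadZ_eq (wt : ℕ × ℕ → ℤ) {Sl : List (ℕ × ℕ)} (hnd : Sl.Nodup) {Λ : ℕ}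
    (hΛ : ∀ p ∈ Sl, p.1 + p.2 ≤ Λ) (Nd : ℕ) :
    ((tHeadZ wt Sl Λ Nd : ℤ) : ℝ) = cellConst Λ 2 Nd 2 *
      taylorFunctional2D (1 / 2) Sl.toFinset (fun p => (wt p : ℝ)) (crossF (1 / 8) (-1) (QN (Nd + 1) 2 2)) := by
  have h := evalR_cellPolyZ wt hnd hΛ 2 Nd (Δ := (2 : ℝ)) (by norm_num)
  have h0 : ((2 : ℝ) - ((2 : ℕ) : ℝ)) / 2 = 0 := by norm_num
  rw [h0, evalR_cellPolyZ_two_zero] at h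
  exact h

/-! ### The form the kernel evaluates: all `U_k(0)`, `k ≤ Λ`, in one pass over the levels -/

/-- `[f i, f (i+1), …]` of length `K`. [folklore] -/
def ltabFrom {α : Type} (f : ℕ → α) : ℕ → ℕ → List α
  | _, 0 => []
  | i, K + 1 => f i :: ltabFrom f (i + 1) K

/-- Lookup with default `0`. [folklore] -/
def lget : List ℤ → ℕ → ℤ
  | [], _ => 0
  | a :: _, 0 => a
  | _ :: as, n + 1 => lget as n

/-- [folklore] -/
theorem lget_ltabFrom (f : ℕ → ℤ) : ∀ (K i n : ℕ), n < K → lget (ltabFrom f i K) n = f (i + n)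
  | 0, _, _, h => absurd h (Nat.not_lt_zero _)
  | K + 1, i, 0, _ => by simp [ltabFrom, lget]
  | K + 1, i, n + 1, h => by
      rw [ltabFrom, lget, lget_ltabFrom f K (i + 1) n (by omega), Nat.add_right_comm, Nat.add_assoc]

/-- One level `m`: add `a · Q̃_k(α)` to entry `k`. [folklore] -/
def uvecStep (a α : ℤ) : List ℤ → List (List ℤ) → List ℤ
  | x :: xs, q :: qs => (x + a * zevalZ q α) :: uvecStep a α xs qs
  | _, _ => []

/-- The zero vector shaped like the `Q̃` table. [folklore] -/
def zeroLike : List (List ℤ) → List ℤ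
  | [] => []
  | _ :: qs => 0 :: zeroLike qs

/-- The `U`-vector after the levels `m' < m`, given the table `QT` of the `Q̃_k`. [folklore] -/
def uvecAux (QT : List (List ℤ)) (Nd c : ℕ) : ℕ → List ℤ
  | 0 => zeroLike QT
  | m + 1 => uvecStep (2 ^ (Nd - m) * ahat0 Nd c m) ((c + m : ℕ) : ℤ) (uvecAux QT Nd c m) QT

/-- **All `U_k(0)`, `k ≤ Λ`** (`N = Nd + 1` levels), computed level by level. [folklore] -/
def uvec (Nd c Λ : ℕ) : List ℤ := uvecAux (ltabFrom qtZ 0 (Λ + 1)) Nd c (Nd + 1)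

/-- [folklore] -/
theorem zeroLike_ltabFrom : ∀ (K i : ℕ), zeroLike (ltabFrom qtZ i K) = ltabFrom (fun _ => (0 : ℤ)) i K
  | 0, i => rfl
  | K + 1, i => by rw [ltabFrom, zeroLike, zeroLike_ltabFrom K (i + 1), ltabFrom]

/-- [folklore] -/
theorem uvecStep_ltabFrom (a α : ℤ) (F : ℕ → ℤ) : ∀ (K i : ℕ),
    uvecStep a α (ltabFrom F i K) (ltabFrom qtZ i K) = ltabFrom (fun k => F k + a * zevalZ (qtZ k) α) i K
  | 0, i => rfl
  | K + 1, i => by rw [ltabFrom, ltabFrom, uvecStep, uvecStep_ltabFrom a α F K (i + 1), ltabFrom]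

/-- [folklore] -/
theorem uvecAux_eq (K i Nd c : ℕ) : ∀ m : ℕ, uvecAux (ltabFrom qtZ i K) Nd c m =
    ltabFrom (fun k => zsumNat (fun m' => 2 ^ (Nd - m') * ahat0 Nd c m' * zevalZ (qtZ k) ((c + m' : ℕ) : ℤ)) m) i K
  | 0 => by rw [uvecAux, zeroLike_ltabFrom]; rfl
  | m + 1 => by rw [uvecAux, uvecAux_eq K i Nd c m, uvecStep_ltabFrom]; rfl

/-- **Entry `k ≤ Λ` of the `U`-vector is `U_k(0)`.** [folklore] -/
theorem lget_uvec {Nd c Λ k : ℕ} (hk : k ≤ Λ) : lget (uvec Nd c Λ) k = u0Z Nd c k := by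
  rw [uvec, uvecAux_eq, lget_ltabFrom _ _ _ _ (by omega), zero_add]
  rfl

/-- The `T` head from two `U`-vectors (what the kernel evaluates). [folklore] -/
def tHeadOf (U2 U0 : List ℤ) (wt : ℕ × ℕ → ℤ) (Sl : List (ℕ × ℕ)) (Λ : ℕ) : ℤ :=
  (Sl.map fun p => omegaZ Λ wt p * (lget U2 p.1 * lget U0 p.2 + lget U0 p.1 * lget U2 p.2)).sum

/-- **The kernel form equals the integer `T` head** (table indices `≤ Λ` in each coordinate). [folklore] -/
theorem tHeadOf_uvec_eq (wt : ℕ × ℕ → ℤ) {Sl : List (ℕ × ℕ)} {Λ : ℕ} (hΛ : ∀ p ∈ Sl, p.1 + p.2 ≤ Λ) (Nd : ℕ) :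
    tHeadOf (uvec Nd 2 Λ) (uvec Nd 0 Λ) wt Sl Λ = tHeadZ wt Sl Λ Nd := by
  rw [tHeadOf, tHeadZ]
  congr 1
  refine List.map_congr_left fun p hp => ?_
  have h := hΛ p hp
  rw [lget_uvec (by omega), lget_uvec (by omega), lget_uvec (by omega), lget_uvec (by omega)]

/-! ### The integer weight and the integer tail -/

/-- The parity weight `(1 - (-1)^{p₁+p₂}) 2^{p₁+p₂}` as an integer. [folklore] -/
def cfacZ (p : ℕ × ℕ) : ℤ := (1 - (-1) ^ (p.1 + p.2)) * 2 ^ (p.1 + p.2)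

/-- [folklore] -/
theorem cast_cfacZ (p : ℕ × ℕ) : ((cfacZ p : ℤ) : ℝ) = cfac p := by
  unfold cfacZ cfac
  push_cast
  ring

/-- The absolute weight `W = Σ_{p∈Sl} |wt_p| c_p` of an integer table, as an integer. [folklore] -/
def wabsZ (wt : ℕ × ℕ → ℤ) (Sl : List (ℕ × ℕ)) : ℤ := (Sl.map fun p => |wt p| * cfacZ p).sum

/-- [folklore] -/
theorem cast_wabsZ (wt : ℕ × ℕ → ℤ) {Sl : List (ℕ × ℕ)} (hnd : Sl.Nodup) :
    ((wabsZ wt Sl : ℤ) : ℝ) = absWeight Sl.toFinset (fun p => (wt p : ℝ)) := by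
  rw [absWeight, List.sum_toFinset _ hnd, wabsZ, Int.cast_list_sum, List.map_map]
  congr 1
  refine List.map_congr_left fun p _ => ?_
  simp only [Function.comp, Int.cast_mul, Int.cast_abs, cast_cfacZ]

/-- **The integer tail**: `tailZ = 8^Λ Λ!² · D₂ D₀ · 2^{Nd+1} · C(Nd+3+Λ, Λ) · (Nd+4) · W`
(`C` through `descFactorial / Λ!`, which the kernel evaluates cheaply). [folklore] -/
def tailZ (wt : ℕ × ℕ → ℤ) (Sl : List (ℕ × ℕ)) (Λ Nd : ℕ) : ℤ :=
  ((8 ^ Λ * Λ.factorial * Λ.factorial * 2 ^ (Nd + 1) * ((Nd + 3 + Λ).descFactorial Λ / Λ.factorial) * (Nd + 4) : ℕ) : ℤ) *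
    (denProd0 Nd 2 * denProd0 Nd 0) * wabsZ wt Sl

/-- **Meaning of the integer tail**: `tailZ = cellConst Λ 2 Nd 2 · ((1/2)^{1/8}(1/2)^{1/8} · 2W · tailMajor Λ (Nd+3)) · (Nd+4-Λ)`
for `Λ < Nd + 4`. [folklore] -/
theorem cast_tailZ (wt : ℕ × ℕ → ℤ) {Sl : List (ℕ × ℕ)} (hnd : Sl.Nodup) {Λ Nd : ℕ} (hΛN : Λ < Nd + 4) :
    ((tailZ wt Sl Λ Nd : ℤ) : ℝ) = cellConst Λ 2 Nd 2 *
      ((1 / 2 : ℝ) ^ (1 / 8 : ℝ) * (1 / 2 : ℝ) ^ (1 / 8 : ℝ) * (2 * absWeight Sl.toFinset (fun p => (wt p : ℝ))) *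
        tailMajor Λ (Nd + 3)) * (((Nd : ℝ) + 4) - Λ) := by
  have hc2 : (0 : ℝ) < (1 / 2 : ℝ) ^ (1 / 8 : ℝ) := Real.rpow_pos_of_pos (by norm_num) _
  have hc2ne : (1 / 2 : ℝ) ^ (1 / 8 : ℝ) ≠ 0 := hc2.ne'
  have h0 : ((2 : ℝ) - ((2 : ℕ) : ℝ)) / 2 = 0 := by norm_num
  have hΛR : (Λ : ℝ) < (Nd : ℝ) + 4 := by exact_mod_cast hΛN
  have hden : ((Nd : ℝ) + 4) - Λ ≠ 0 := by linarith
  have hM : ((Nd + 3 : ℕ) : ℝ) + 1 = (Nd : ℝ) + 4 := by push_cast; ring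
  -- the majorant times `(Nd+4-Λ)` has no denominator
  have htm : tailMajor Λ (Nd + 3) * (((Nd : ℝ) + 4) - Λ) =
      (1 / 2 : ℝ) ^ (Nd + 3) * (((Nd + 3 + Λ).choose Λ : ℕ) : ℝ) * (2 * ((Nd : ℝ) + 4)) := by
    rw [tailMajor, hM, mul_div_assoc', div_mul_cancel₀ _ hden]
  rw [show cellConst Λ 2 Nd 2 * ((1 / 2 : ℝ) ^ (1 / 8 : ℝ) * (1 / 2 : ℝ) ^ (1 / 8 : ℝ) *
      (2 * absWeight Sl.toFinset (fun p => (wt p : ℝ))) * tailMajor Λ (Nd + 3)) * (((Nd : ℝ) + 4) - Λ) =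
      cellConst Λ 2 Nd 2 * ((1 / 2 : ℝ) ^ (1 / 8 : ℝ) * (1 / 2 : ℝ) ^ (1 / 8 : ℝ) *
      (2 * absWeight Sl.toFinset (fun p => (wt p : ℝ)))) * (tailMajor Λ (Nd + 3) * (((Nd : ℝ) + 4) - Λ)) by ring, htm]
  rw [tailZ, ← Nat.choose_eq_descFactorial_div_factorial, Int.cast_mul, Int.cast_mul, cast_wabsZ wt hnd]
  unfold cellConst
  rw [h0, denProd_zero_eq, denProd_zero_eq, Real.rpow_two, show ((1 : ℝ) / 2) ^ 2 = 1 / 4 by norm_num]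
  have h4 : (4 : ℝ) ^ Nd = 2 ^ Nd * 2 ^ Nd := by rw [← mul_pow]; norm_num
  have h2 : ((1 : ℝ) / 2) ^ (Nd + 3) = 1 / (2 ^ Nd * 8) := by rw [one_div_pow, pow_add]; norm_num
  rw [h4, h2]
  push_cast
  field_simp
  ring

/-! ### Kind `ope2`, sense lower, from kernel data -/

/-- **Kind `ope2`, sense LOWER, from KERNEL data** (`Δ_σ = 1/8`, bound `P = Pn/Pd`, scalar `T` truncation `Nd` with
`Nd + 3 ≥ E₀`, `Λ < Nd + 4`): (I′) as the integer inequality `0 < Pd · identZ · 4^{Nd+1} · D₂ D₀ + Pn · T̂` and the SIGN CHECK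
`T̂ · (Nd+4-Λ) + tailZ < 0`, `T̂ = tHeadOf (uvec Nd 2 Λ) (uvec Nd 0 Λ) wt Sl Λ`, `D_c = denProd0 Nd c` (both decidable by
`decide +kernel` on a replay's table), plus (R) and the kind-`ope2` cells record `OpeCellsN`, give `OpeLowerA2D (1/8) G δ e₁ e₂ (Pn/Pd)` (`P < p_T`).
PROVED (`tHeadOf_uvec_eq`, `tHeadZ_eq`, `cast_tailZ`, the normalisation of `opeUpper_half_of_cellsZ`, then `opeLower_half_of_cellsN`).
[cite: RattazziEtAl2008, §5] -/
theorem opeLower_half_of_cellsZ (wt : ℕ × ℕ → ℤ) {Sl : List (ℕ × ℕ)} (hnd : Sl.Nodup) {Λ : ℕ}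
    (hΛ : ∀ p ∈ Sl, p.1 + p.2 ≤ Λ) {G δ e₁ e₂ E₀ : ℝ} {Pn Pd Nd : ℕ}
    (he : 1 / 4 < e₁) (hG : 1 / 4 < G) (hδ : 0 ≤ δ) (hPd : 0 < Pd)
    (hNd : E₀ ≤ 2 + ((Nd + 1 : ℕ) : ℝ)) (hΛN : Λ < Nd + 4)
    (hIT : 0 < (Pd : ℤ) * (identZ wt Sl Λ * (4 ^ (Nd + 1) * (denProd0 Nd 2 * denProd0 Nd 0))) +
      (Pn : ℤ) * tHeadOf (uvec Nd 2 Λ) (uvec Nd 0 Λ) wt Sl Λ)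
    (hTX : tHeadOf (uvec Nd 2 Λ) (uvec Nd 0 Λ) wt Sl Λ * ((Nd + 4 - Λ : ℕ) : ℤ) + tailZ wt Sl Λ Nd < 0)
    (hR : ∀ (b : ℝ) (J : ℕ), 0 ≤ b → E₀ ≤ 2 * b + J →
      0 ≤ ∑ p ∈ Sl.toFinset, (wt p : ℝ) * ((1 - (-1 : ℝ) ^ (p.1 + p.2)) * 2 ^ (p.1 + p.2) *
        (qFactor₁ (1 / 8) (b + J) p.1 * qFactor₁ (1 / 8) b p.2 +
          qFactor₁ (1 / 8) b p.1 * qFactor₁ (1 / 8) (b + J) p.2)))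
    (hc : OpeCellsN Sl.toFinset (fun p => (wt p : ℝ)) (1 / 8) G δ e₁ e₂ E₀) :
    OpeLowerA2D (1 / 8) G δ e₁ e₂ ((Pn : ℝ) / Pd) := by
  rw [tHeadOf_uvec_eq wt hΛ Nd] at hIT hTX
  set φ1 := taylorFunctional2D (1 / 2) Sl.toFinset (fun p => (wt p : ℝ))
    (crossF (1 / 8) (-1) (fun _ _ => (1 : ℝ))) with hφ1
  set φT := taylorFunctional2D (1 / 2) Sl.toFinset (fun p => (wt p : ℝ))
    (crossF (1 / 8) (-1) (QN (Nd + 1) 2 2)) with hφT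
  set c2 : ℝ := (1 / 2 : ℝ) ^ (1 / 8 : ℝ) * (1 / 2 : ℝ) ^ (1 / 8 : ℝ) with hc2
  have hc2pos : 0 < c2 := by
    have h3 : (0 : ℝ) < (1 / 2 : ℝ) ^ (1 / 8 : ℝ) := Real.rpow_pos_of_pos (by norm_num) _
    rw [hc2]; positivity
  have hK := regConst_pos Λ
  have hPdR : (0 : ℝ) < Pd := by exact_mod_cast hPd
  have hD2 : (0 : ℝ) < ((denProd0 Nd 2 : ℤ) : ℝ) := by rw [← denProd_zero_eq]; exact denProd_pos Nd 2 (by norm_num)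
  have hD0 : (0 : ℝ) < ((denProd0 Nd 0 : ℤ) : ℝ) := by rw [← denProd_zero_eq]; exact denProd_pos Nd 0 (by norm_num)
  have hCC : 0 < cellConst Λ 2 Nd 2 := cellConst_pos Λ 2 Nd (by norm_num)
  -- (I): `regConst · φ1 = c2 · identZ`
  have h1 : regConst Λ * φ1 = c2 * (identZ wt Sl Λ : ℝ) := regConst_mul_taylorFunctional2D_one wt hnd hΛ
  -- the `T` head: `T̂ = cellConst · φT`, `cellConst = regConst · 4^Nd · D₂ · D₀ / (c2/4)`
  have h2 := tHeadZ_eq wt hnd hΛ Nd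
  have h0 : ((2 : ℝ) - ((2 : ℕ) : ℝ)) / 2 = 0 := by norm_num
  have hcc : cellConst Λ 2 Nd 2 = regConst Λ * 4 ^ Nd * ((denProd0 Nd 2 : ℤ) : ℝ) * ((denProd0 Nd 0 : ℤ) : ℝ) *
      (c2 * (1 / 4))⁻¹ := by
    rw [hc2]
    unfold cellConst regConst
    rw [h0, denProd_zero_eq, denProd_zero_eq, Real.rpow_two, show ((1 : ℝ) / 2) ^ 2 = 1 / 4 by norm_num]
  -- `regConst · 4^{Nd+1} · D₂ · D₀ · φT = c2 · T̂`
  have h2' : regConst Λ * 4 ^ (Nd + 1) * ((denProd0 Nd 2 : ℤ) : ℝ) * ((denProd0 Nd 0 : ℤ) : ℝ) * φT =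
      c2 * ((tHeadZ wt Sl Λ Nd : ℤ) : ℝ) := by
    rw [h2, hcc]
    field_simp
    ring
  have hITR : (0 : ℝ) < (Pd : ℝ) * ((identZ wt Sl Λ : ℝ) * (4 ^ (Nd + 1) *
      (((denProd0 Nd 2 : ℤ) : ℝ) * ((denProd0 Nd 0 : ℤ) : ℝ)))) + (Pn : ℝ) * ((tHeadZ wt Sl Λ Nd : ℤ) : ℝ) := by
    exact_mod_cast hIT
  have hI' : 0 < φ1 + ((Pn : ℝ) / Pd) * φT := by
    have key : regConst Λ * (Pd : ℝ) * 4 ^ (Nd + 1) * ((denProd0 Nd 2 : ℤ) : ℝ) * ((denProd0 Nd 0 : ℤ) : ℝ) *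
        (φ1 + ((Pn : ℝ) / Pd) * φT) =
        c2 * ((Pd : ℝ) * ((identZ wt Sl Λ : ℝ) * (4 ^ (Nd + 1) *
          (((denProd0 Nd 2 : ℤ) : ℝ) * ((denProd0 Nd 0 : ℤ) : ℝ)))) + (Pn : ℝ) * ((tHeadZ wt Sl Λ Nd : ℤ) : ℝ)) := by
      have hPd0 : (Pd : ℝ) ≠ 0 := ne_of_gt hPdR
      field_simp
      linear_combination ((Pd : ℝ) * 4 ^ (Nd + 1) * ((denProd0 Nd 2 : ℤ) : ℝ) * ((denProd0 Nd 0 : ℤ) : ℝ)) * h1 +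
        (Pn : ℝ) * h2'
    have hM : 0 < regConst Λ * (Pd : ℝ) * 4 ^ (Nd + 1) * ((denProd0 Nd 2 : ℤ) : ℝ) * ((denProd0 Nd 0 : ℤ) : ℝ) := by
      positivity
    have := mul_pos hc2pos hITR
    rw [← key] at this
    exact (mul_pos_iff_of_pos_left hM).mp this
  -- the sign check: `cellConst · (φT + tail) · (Nd+4-Λ) = T̂·(Nd+4-Λ) + tailZ < 0`
  have hΛR : (Λ : ℝ) < (Nd : ℝ) + 4 := by exact_mod_cast hΛN
  have hsub : ((Nd + 4 - Λ : ℕ) : ℝ) = ((Nd : ℝ) + 4) - Λ := by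
    rw [Nat.cast_sub hΛN.le]; push_cast; ring
  have hTXR : ((tHeadZ wt Sl Λ Nd : ℤ) : ℝ) * (((Nd : ℝ) + 4) - Λ) + ((tailZ wt Sl Λ Nd : ℤ) : ℝ) < 0 := by
    rw [← hsub]; exact_mod_cast hTX
  have hT : φT + (1 / 2 : ℝ) ^ (1 / 8 : ℝ) * (1 / 2 : ℝ) ^ (1 / 8 : ℝ) *
      (2 * absWeight Sl.toFinset (fun p => (wt p : ℝ))) * tailMajor Λ (Nd + 1 + 2) < 0 := by
    rw [show Nd + 1 + 2 = Nd + 3 by ring]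
    rw [h2, cast_tailZ wt hnd hΛN] at hTXR
    have hpos : 0 < cellConst Λ 2 Nd 2 * (((Nd : ℝ) + 4) - Λ) := mul_pos hCC (by linarith)
    have key : cellConst Λ 2 Nd 2 * φT * (((Nd : ℝ) + 4) - Λ) +
        cellConst Λ 2 Nd 2 * ((1 / 2 : ℝ) ^ (1 / 8 : ℝ) * (1 / 2 : ℝ) ^ (1 / 8 : ℝ) *
          (2 * absWeight Sl.toFinset (fun p => (wt p : ℝ))) * tailMajor Λ (Nd + 3)) * (((Nd : ℝ) + 4) - Λ) =
        (cellConst Λ 2 Nd 2 * (((Nd : ℝ) + 4) - Λ)) * (φT + (1 / 2 : ℝ) ^ (1 / 8 : ℝ) * (1 / 2 : ℝ) ^ (1 / 8 : ℝ) *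
          (2 * absWeight Sl.toFinset (fun p => (wt p : ℝ))) * tailMajor Λ (Nd + 3)) := by ring
    rw [key] at hTXR
    exact neg_of_mul_neg_right hTXR hpos.le
  have hΛ' : ∀ p ∈ Sl.toFinset, p.1 ≤ Λ ∧ p.2 ≤ Λ := by
    intro p hp
    have := hΛ p (List.mem_toFinset.mp hp)
    exact ⟨by omega, by omega⟩
  exact opeLower_half_of_cellsN Sl.toFinset (fun p => (wt p : ℝ)) (Λ := Λ) (NT := Nd + 1) (by norm_num) (by norm_num)
    (by linarith) (by linarith) hδ (by positivity) hNd hΛ' (by omega) (by omega) hI' hT hR hc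

end Summit.CriticalPhenomena.Ising3D.Control2D
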